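import Literature.NumberTheory.QuadraticFields.QuadraticDedekindZeta
import Literature.NumberTheory.QuadraticFields.KroneckerCharacterEvenDiscriminant
import Literature.NumberTheory.QuadraticFields.JacobiCharacterPrimitiveProofs
import Literature.NumberTheory.EllipticCurves.CMNewformOfHeckeCharacterProofs
import Literature.NumberTheory.GaloisRepresentations.PrimaryGeneratorHeckeCharacter
import Literature.NumberTheory.LFunctions.IdealNormCount
import Mathlib.NumberTheory.LSeries.Injectivity
import Mathlib.NumberTheory.LSeries.Convolution
import Mathlib.NumberTheory.LegendreSymbol.JacobiSymbol
import Mathlib.NumberTheory.NumberField.InfinitePlace.TotallyRealComplex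
import Mathlib.NumberTheory.NumberField.Discriminant.Basic
import HarnessLib

/-!
# Ribet 1977 §3 with trivial Nebentypus at weight `k`: the Kronecker character, `ψ̃((m)) = κ(m) m^{k-1}`,
# and the parity of `k` (proofs only)

Topic `NumberTheory/EllipticCurves`; namespace `Literature.NumberTheory.EllipticCurves.ModularForms`.
First sibling proof file of `CMNewformGamma0OfGrossencharakter.lean` (named fact
`Ribet1977_cmNewform_gamma0_of_isGrossencharakter`: Ribet, LNM 601 (1977), §3, Thm. (3.4) and Cor. (3.5),
pp. 34–35, trivial Nebentypus `ε = 1`).  THEOREMS ONLY — no definition, no named fact (D-0026).  The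
second sibling, `CMNewformGamma0OfGrossencharakterProofs.lean`, derives the fact at every weight `k ≥ 2`
from ONE printed input (the weight-`k` Hecke theta cusp form, Thm. (3.4) first sentence).  Here: the
elementary character bookkeeping of Ribet §3 — "Let `φ` be the Dirichlet character associated to `F` …
let `η` be the Dirichlet character mod `M` given by `a ↦ ψ((a))/σa^{k-1}` … Let `ε` be the product `ηφ`"
— in the tree's ideal-theoretic vocabulary and at weight `k` (the Summit-side `HeckeTheta` files of
route `ResidualThetaTransportAtTwo` do the same at `k = 2`; Literature cannot import them, so the three
small glue statements about the Kronecker character are re-proved here under new names):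

* `exists_kroneckerChar_odd_jacobiSym_dedekindZeta` — the Kronecker character `κ` of an imaginary
  quadratic `K`: odd, `κ(n) = (d_K/n)` (Jacobi symbol) at odd `n`, `ζ_K = ζ · L(κ)`;
* (private `idealNormCount_eq_sum_divisors_of_dedekindZeta_eq`) `kroneckerChar_natGenerator_eq_one_of_pair`,
  `kroneckerChar_natGenerator_eq_neg_one_of_singleton` — the decomposition law read off
  `#{𝔞 : N𝔞 = p} = 1 + κ(p)`: `κ(p) = 1` at a split, `-1` at an inert prime;
* (private `prod_embedding_zpow_embType_mul`) `idealPow_span_eq_of_isGrossencharakter_weight` — the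
  Größencharakter relation `ψ̃((b)) = ψ̃((c)) σ(b/c)^{k-1}` on the ray `b ≡ c mod 𝔪` for the infinity
  type `(k-1)·(1,0)` at `σ` ("`ψ((a)) = σ(a)^{k-1}` for all `a ≡ 1 mod^× 𝔪`");
* `idealPow_span_natCast_eq_kroneckerChar_mul_pow` — under the clause `ψ̃((n)) = (d_K/n) n^{k-1}`
  (odd `n` prime to `|d_K| N𝔪`; Ribet's `η = φ`), `ψ̃((m)) = κ(m) m^{k-1}` for EVERY natural `m` prime
  to `|d_K| N𝔪` (even `m` through the odd `m + |d_K| N𝔪`);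
* `even_weight_of_trivial_nebentypus` — the clause forces `k` even (`n = 2|d_K|N𝔪 - 1 ≡ -1`:
  `ψ̃((n)) = (-n)^{k-1}` against `(d_K/n) = κ(-1) = -1`), so the fact is vacuous at odd `k`
  (consistent with `S_k(Γ₀(N)) = 0` for odd `k`; cf. Ribet §4, proof of (4.1):
  `det ρ_λ(c) = (-1)^{k-1} ε(-1) = -1`).

No summit statement (BirchSwinnertonDyer) is proved by this file; the named fact is not discharged here.

## References

* K. A. Ribet, *Galois representations attached to eigenforms with Nebentypus*, LNM 601 (1977), §3,
  pp. 34–35; §4, Prop. (4.1). [Ribet1977Nebentypus]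
* D. A. Cox, *Primes of the form x² + ny²* (2013), §1.C Lemma 1.14 (the Kronecker character). [Cox2013]
* J. Neukirch, *Algebraic Number Theory* (1999), Ch. I (8.2), (9.2); Ch. VII §6 Def. (6.1). [NeukirchANT1999]
-/

set_option autoImplicit false

noncomputable section

open scoped NumberField ComplexConjugate Real NumberTheorySymbols
open NumberField Module Complex Filter IsDedekindDomain

namespace Literature.NumberTheory.EllipticCurves.ModularForms

open Literature.NumberTheory.LFunctions (idealPow rayClassCoeff idealPow_top idealNormCount)
open Literature.NumberTheory.GaloisRepresentations (IsGrossencharakter embType embTypeConj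
  prod_embedding_zpow_embType)
open Literature.NumberTheory.QuadraticFields (jacobiChar jacobiChar_natCast isPrimitive_jacobiChar
  isQuadratic_jacobiChar jacobiChar_neg_one_of_mod_four_eq_three jacobiSym_natAbs_eq_of_emod_four_eq_one)
open Literature.NumberTheory.QuadraticFields.Quadratic (isFundamentalDiscriminant_discr
  dedekindZeta_eq_riemannZeta_mul_LSeries exists_kroneckerChar_of_four_dvd)

variable {K : Type} [Field K] [NumberField K]

/-! ### The Kronecker character of an imaginary quadratic field -/

/-- **The Kronecker character of an imaginary quadratic field**: a primitive, odd, quadratic Dirichlet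
character `κ` mod `|d_K|` with `κ(n) = (d_K/n)` (Jacobi symbol) for odd `n` and `ζ_K(s) = ζ(s) L(s, κ)`
for `Re s > 1` (Cox, Lemma 1.14 / (1.18); odd `d_K`: the Jacobi character `jacobiChar |d_K|`, even
`d_K`: `exists_kroneckerChar_of_four_dvd`).  Literature twin of the Summit-side glue
`HeckeTheta.exists_kroneckerChar_imQuad`. [cite: Cox2013, §1.C Lemma 1.14] -/
theorem exists_kroneckerChar_odd_jacobiSym_dedekindZeta (hK : finrank ℚ K = 2) [IsTotallyComplex K] :
    ∃ κ : DirichletCharacter ℂ (NumberField.discr K).natAbs,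
      κ.IsPrimitive ∧ κ.Odd ∧ κ ^ 2 = 1 ∧
      (∀ n : ℕ, Odd n → κ n = (jacobiSym (NumberField.discr K) n : ℂ)) ∧
      ∀ s : ℂ, 1 < s.re →
        NumberField.dedekindZeta K s = riemannZeta s * LSeries (fun n => κ n) s := by
  have hneg : NumberField.discr K < 0 := by
    have h := NumberField.sign_discr (K := K)
    have hr : InfinitePlace.nrComplexPlaces K = 1 := by
      have := NumberField.IsTotallyComplex.finrank (K := K)
      omega
    rw [hr, pow_one] at h
    exact Int.sign_eq_neg_one_iff_neg.mp h
  rcases isFundamentalDiscriminant_discr (K := K) hK with ⟨h1, hsq, -⟩ | ⟨h4, -, -⟩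
  · -- odd discriminant: the Jacobi character mod `|d_K|`
    have hodd : Odd (NumberField.discr K) := by rw [Int.odd_iff]; omega
    have hoddD : Odd (NumberField.discr K).natAbs := Int.natAbs_odd.mpr hodd
    have hsqD : Squarefree (NumberField.discr K).natAbs := Int.squarefree_natAbs.mpr hsq
    have h3 : (NumberField.discr K).natAbs % 4 = 3 := by omega
    refine ⟨jacobiChar (NumberField.discr K).natAbs, isPrimitive_jacobiChar hoddD hsqD,
      jacobiChar_neg_one_of_mod_four_eq_three h3, isQuadratic_jacobiChar.sq_eq_one,
      fun n hn => ?_, fun s hs => dedekindZeta_eq_riemannZeta_mul_LSeries hK hodd hs⟩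
    rw [jacobiChar_natCast, jacobiSym_natAbs_eq_of_emod_four_eq_one h1 hn]
  · -- even discriminant
    obtain ⟨κ, hprim, hquad, -, hval, -, hodd, hζ⟩ := exists_kroneckerChar_of_four_dvd hK h4
    exact ⟨κ, hprim, hodd hneg, hquad.sq_eq_one, fun n hn => hval n hn.pos.ne', hζ⟩

/-! ### The decomposition law from the count of ideals of prime norm -/

/-- **Coefficient comparison**: if `ζ_K(s) = ζ(s) L(s, κ)` for `Re s > 1` with `|κ| ≤ 1`, then
`#{𝔞 ⊆ 𝓞_K : N𝔞 = n} = Σ_{m ∣ n} κ(m)` for every `n ≥ 1` (`L`-series injectivity, Mathlib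
`LSeries.eq_of_LSeries_eventually_eq`; Dirichlet convolution `1 ⋆ κ`).  Literature twin of the
Summit-side `HeckeTheta.idealNormCount_eq_sum_divisors`. [folklore] -/
private theorem idealNormCount_eq_sum_divisors_of_dedekindZeta_eq {κ : ℕ → ℂ} (hκ : ∀ n, ‖κ n‖ ≤ 1)
    (hζ : ∀ s : ℂ, 1 < s.re → NumberField.dedekindZeta K s = riemannZeta s * LSeries κ s)
    {n : ℕ} (hn : n ≠ 0) : (idealNormCount K n : ℂ) = ∑ m ∈ n.divisors, κ m := by
  set f : ℕ → ℂ := fun n => (idealNormCount K n : ℂ) with hfdef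
  set g : ℕ → ℂ := LSeries.convolution 1 κ with hgdef
  -- abscissas of absolute convergence
  have hκa : LSeries.abscissaOfAbsConv κ ≤ 1 :=
    LSeries.abscissaOfAbsConv_le_of_le_const ⟨1, fun n _ => hκ n⟩
  have h1a : LSeries.abscissaOfAbsConv (1 : ℕ → ℂ) ≤ 1 :=
    LSeries.abscissaOfAbsConv_le_of_le_const ⟨1, fun n _ => by simp⟩
  have hf2 : LSeriesSummable f 2 := by
    have := Literature.NumberTheory.LFunctions.LSeriesSummable_dedekindZeta (K := K) (s := 2) (by norm_num)
    exact this
  have hfa : LSeries.abscissaOfAbsConv f < ⊤ :=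
    lt_of_le_of_lt hf2.abscissaOfAbsConv_le (by simp)
  have h2re : (1 : EReal) < ((2 : ℂ).re : EReal) := by
    have : (2 : ℂ).re = 2 := by simp
    rw [this]; exact_mod_cast one_lt_two
  have hκ2 : LSeriesSummable κ 2 := LSeriesSummable_of_abscissaOfAbsConv_lt_re
    (lt_of_le_of_lt hκa h2re)
  have h12 : LSeriesSummable (1 : ℕ → ℂ) 2 := LSeriesSummable_of_abscissaOfAbsConv_lt_re
    (lt_of_le_of_lt h1a h2re)
  have hg2 : LSeriesSummable g 2 := h12.convolution hκ2
  have hga : LSeries.abscissaOfAbsConv g < ⊤ :=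
    lt_of_le_of_lt hg2.abscissaOfAbsConv_le (by simp)
  -- `L(f, x) = L(g, x)` for real `x > 1`
  have hev : (fun x : ℝ => LSeries f x) =ᶠ[atTop] fun x => LSeries g x := by
    filter_upwards [eventually_gt_atTop (1 : ℝ)] with x hx
    have hx' : 1 < (x : ℂ).re := by simpa using hx
    have h := hζ x hx'
    rw [Literature.NumberTheory.LFunctions.dedekindZeta_eq_LSeries] at h
    rw [hfdef, h, hgdef, ← LSeries_one_eq_riemannZeta hx',
      LSeries_convolution (lt_of_le_of_lt h1a (by exact_mod_cast hx)) (lt_of_le_of_lt hκa (by exact_mod_cast hx))]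
  have h := LSeries.eq_of_LSeries_eventually_eq hfa hga hev hn
  change f n = _
  rw [h, hgdef, LSeries.convolution_def]
  simp only
  rw [Nat.sum_divisorsAntidiagonal' (fun k m => (1 : ℕ → ℂ) k * κ m)]
  exact Finset.sum_congr rfl fun m _ => by simp

/-- **Split prime: `κ(p) = 1`.**  If `ζ_K = ζ · L(κ)` and the places of `K` above `v` are a pair
`w₁ ≠ w₂` of residue degree one, then `κ(p_v) = 1`: there are two ideals of norm `p`
(`setOf_absNorm_eq_of_pair`) and `#{𝔞 : N𝔞 = p} = 1 + κ(p)`.  Literature twin of the Summit-side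
`HeckeTheta.kroneckerChar_eq_of_pair`. [cite: NeukirchANT1999, Ch. I, Prop. (8.2)] -/
theorem kroneckerChar_natGenerator_eq_one_of_pair {κ : DirichletCharacter ℂ (NumberField.discr K).natAbs}
    (hζ : ∀ s : ℂ, 1 < s.re → NumberField.dedekindZeta K s = riemannZeta s * LSeries (fun n => κ n) s)
    (v : HeightOneSpectrum (𝓞 ℚ)) {w₁ w₂ : HeightOneSpectrum (𝓞 K)} (hne : w₁ ≠ w₂)
    (hS : {w : HeightOneSpectrum (𝓞 K) | w.asIdeal.under (𝓞 ℚ) = v.asIdeal} = {w₁, w₂})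
    (h₁ : w₁.asIdeal.inertiaDeg (𝓞 ℚ) = 1) (h₂ : w₂.asIdeal.inertiaDeg (𝓞 ℚ) = 1) :
    κ (Rat.HeightOneSpectrum.natGenerator v) = 1 := by
  have hp := Rat.HeightOneSpectrum.prime_natGenerator v
  have hcount := idealNormCount_eq_sum_divisors_of_dedekindZeta_eq (K := K) (κ := fun n => κ n)
    (fun m => κ.norm_le_one _) hζ hp.ne_zero
  rw [hp.divisors, Finset.sum_pair hp.one_lt.ne] at hcount
  simp only [Nat.cast_one, MulChar.map_one] at hcount
  have hncard : idealNormCount K (Rat.HeightOneSpectrum.natGenerator v) =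
      ({I : Ideal (𝓞 K) | Ideal.absNorm I = Rat.HeightOneSpectrum.natGenerator v} : Set (Ideal (𝓞 K))).ncard := by
    rw [idealNormCount, ← Nat.card_coe_set_eq]; rfl
  rw [hncard, setOf_absNorm_eq_of_pair v hS h₁ h₂,
    Set.ncard_pair (fun h => hne (HeightOneSpectrum.ext h))] at hcount
  norm_num at hcount
  linear_combination -hcount

/-- **Inert prime: `κ(p) = -1`.**  If `ζ_K = ζ · L(κ)` and the only place of `K` above `v` has residue
degree two, then `κ(p_v) = -1`: no ideal has norm `p` (`setOf_absNorm_eq_of_singleton`).  Literature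
twin of the Summit-side `HeckeTheta.kroneckerChar_eq_of_singleton`. [cite: NeukirchANT1999, Ch. I, Prop. (8.2)] -/
theorem kroneckerChar_natGenerator_eq_neg_one_of_singleton
    {κ : DirichletCharacter ℂ (NumberField.discr K).natAbs}
    (hζ : ∀ s : ℂ, 1 < s.re → NumberField.dedekindZeta K s = riemannZeta s * LSeries (fun n => κ n) s)
    (v : HeightOneSpectrum (𝓞 ℚ)) {w : HeightOneSpectrum (𝓞 K)}
    (hS : {w : HeightOneSpectrum (𝓞 K) | w.asIdeal.under (𝓞 ℚ) = v.asIdeal} = {w})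
    (hw : w.asIdeal.inertiaDeg (𝓞 ℚ) = 2) :
    κ (Rat.HeightOneSpectrum.natGenerator v) = -1 := by
  have hp := Rat.HeightOneSpectrum.prime_natGenerator v
  have hcount := idealNormCount_eq_sum_divisors_of_dedekindZeta_eq (K := K) (κ := fun n => κ n)
    (fun m => κ.norm_le_one _) hζ hp.ne_zero
  rw [hp.divisors, Finset.sum_pair hp.one_lt.ne] at hcount
  simp only [Nat.cast_one, MulChar.map_one] at hcount
  have hncard : idealNormCount K (Rat.HeightOneSpectrum.natGenerator v) =
      ({I : Ideal (𝓞 K) | Ideal.absNorm I = Rat.HeightOneSpectrum.natGenerator v} : Set (Ideal (𝓞 K))).ncard := by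
    rw [idealNormCount, ← Nat.card_coe_set_eq]; rfl
  rw [hncard, setOf_absNorm_eq_of_singleton v hS hw, Set.ncard_empty] at hcount
  norm_num at hcount
  linear_combination -hcount

/-- `(n) + 𝔪 = 1` for a natural number `n` prime to `M = N𝔪` (`M ∈ 𝔪`, Mathlib `Ideal.absNorm_mem`).
Literature twin of the Summit-side `HeckeTheta.isCoprime_span_natCast`. [folklore] -/
private theorem isCoprime_span_natCast_of_coprime_absNorm {𝔪 : Ideal (𝓞 K)} {n : ℕ}
    (hn : n.Coprime (Ideal.absNorm 𝔪)) : IsCoprime (Ideal.span {(n : 𝓞 K)}) 𝔪 := by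
  rw [Ideal.isCoprime_iff_exists]
  obtain ⟨u, v, huv⟩ := Nat.Coprime.isCoprime hn
  refine ⟨(u : 𝓞 K) * n, Ideal.mul_mem_left _ _ (Ideal.mem_span_singleton_self _),
    (v : 𝓞 K) * (Ideal.absNorm 𝔪 : 𝓞 K), Ideal.mul_mem_left _ _ (Ideal.absNorm_mem 𝔪), ?_⟩
  have := congrArg (fun z : ℤ => (z : 𝓞 K)) huv
  push_cast at this
  exact this

/-! ### The Größencharakter relation at weight `k` -/

/-- `∏_w σ_w(x)^{m p_w} σ̄_w(x)^{m q_w} = σ(x)^m` for the type `(p, q) = (embType σ, embTypeConj σ)`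
(only the place of `σ` contributes, `prod_embedding_zpow_embType`). [folklore] -/
private theorem prod_embedding_zpow_embType_mul (σ : K →+* ℂ) (m : ℤ) (x : K) :
    ∏ w : InfinitePlace K, w.embedding x ^ (m * embType σ w) * conj (w.embedding x) ^ (m * embTypeConj σ w) =
      σ x ^ m := by
  rw [← prod_embedding_zpow_embType σ x, ← Finset.prod_zpow]
  refine Finset.prod_congr rfl fun w _ => ?_
  rw [mul_zpow, mul_comm m (embType σ w), zpow_mul, mul_comm m (embTypeConj σ w), zpow_mul]

/-- **The weight-`k` relation `ψ̃((b)) = ψ̃((c)) σ(b/c)^{k-1}` on the ray**, from `IsGrossencharakter`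
with the infinity type `(k-1)·(1, 0)` at `σ` (Ribet 1977 §3: "`ψ((a)) = σ(a)^{k-1}` for all
`a ≡ 1 mod^× 𝔪`"; an imaginary quadratic field has no real place, so the positivity clause is
vacuous). [cite: Ribet1977Nebentypus, §3 (LNM 601, p. 34)] -/
theorem idealPow_span_eq_of_isGrossencharakter_weight [IsTotallyComplex K] (σ : K →+* ℂ) (k : ℕ)
    {𝔪 : Ideal (𝓞 K)} {ψ : HeightOneSpectrum (𝓞 K) → ℂ}
    (hψG : IsGrossencharakter 𝔪 (fun w => ((k : ℤ) - 1) * embType σ w)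
      (fun w => ((k : ℤ) - 1) * embTypeConj σ w) ψ)
    (b c : 𝓞 K) (hb : b ≠ 0) (hc : c ≠ 0) (hcop : IsCoprime (Ideal.span {c}) 𝔪) (hbc : b - c ∈ 𝔪) :
    idealPow K ψ (Ideal.span {b}) = idealPow K ψ (Ideal.span {c}) * σ ((b : K) / c) ^ ((k : ℤ) - 1) := by
  have hpos : ∀ φ : K →+* ℝ, 0 < φ b * φ c := by
    intro φ
    exfalso
    refine NumberField.IsTotallyComplex.complexEmbedding_not_isReal ((algebraMap ℝ ℂ).comp φ) ?_
    rw [NumberField.ComplexEmbedding.isReal_iff]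
    ext x
    simp [NumberField.ComplexEmbedding.conjugate_coe_eq]
  have h := hψG.idealPow_span_eq b c hb hc hcop hbc hpos
  beta_reduce at h
  rwa [prod_embedding_zpow_embType_mul] at h

/-- `x ^ ((k : ℤ) - 1) = x ^ (k - 1)` for `1 ≤ k` (the weight exponent as a natural power). [folklore] -/
private theorem zpow_natCast_weight_sub_one (x : ℂ) {k : ℕ} (hk : 1 ≤ k) : x ^ ((k : ℤ) - 1) = x ^ (k - 1) := by
  rw [show ((k : ℤ) - 1) = ((k - 1 : ℕ) : ℤ) by omega, zpow_natCast]

/-! ### The values `ψ̃((m)) = κ(m) m^{k-1}` under the trivial-Nebentypus clause -/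

/-- **`ψ̃((m)) = κ(m) · m^{k-1}` for every natural number `m` prime to `|d_K| N𝔪`** under the clause
`ψ̃((n)) = (d_K/n) n^{k-1}` for odd such `n` (Ribet's `η = φ`: `η(a) = ψ((a))/σ(a)^{k-1}` has period
`M`, `φ = κ` has period `D`): odd `m` directly (`κ(n) = (d_K/n)` at odd `n`), even `m` through the odd
representative `m + |d_K| N𝔪` of its class (then `|d_K| N𝔪` is odd) and the weight-`k` relation on the
ray. [cite: Ribet1977Nebentypus, §3 (LNM 601, p. 34)] -/
theorem idealPow_span_natCast_eq_kroneckerChar_mul_pow [IsTotallyComplex K] (hK : finrank ℚ K = 2)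
    (σ : K →+* ℂ) {k : ℕ} (hk : 1 ≤ k) {κ : DirichletCharacter ℂ (discr K).natAbs}
    (hκJ : ∀ n : ℕ, Odd n → κ n = (jacobiSym (discr K) n : ℂ))
    {𝔪 : Ideal (𝓞 K)} {ψ : HeightOneSpectrum (𝓞 K) → ℂ}
    (hψG : IsGrossencharakter 𝔪 (fun w => ((k : ℤ) - 1) * embType σ w)
      (fun w => ((k : ℤ) - 1) * embTypeConj σ w) ψ)
    (hneb : ∀ n : ℕ, Odd n → n.Coprime ((discr K).natAbs * Ideal.absNorm 𝔪) →
      idealPow K ψ (Ideal.span {(n : 𝓞 K)}) = (jacobiSym (discr K) n : ℂ) * (n : ℂ) ^ (k - 1))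
    {m : ℕ} (hm : m.Coprime ((discr K).natAbs * Ideal.absNorm 𝔪)) :
    idealPow K ψ (Ideal.span {(m : 𝓞 K)}) = κ m * (m : ℂ) ^ (k - 1) := by
  classical
  set M : ℕ := Ideal.absNorm 𝔪 with hMdef
  have hD3 : 2 < (discr K).natAbs := by
    have h := NumberField.abs_discr_gt_two (K := K) (by rw [hK]; norm_num)
    have : (2 : ℤ) < ((discr K).natAbs : ℤ) := by rw [Int.natCast_natAbs]; exact h
    exact_mod_cast this
  have hN1 : (discr K).natAbs * M ≠ 1 := by
    intro h
    have := Nat.eq_one_of_mul_eq_one_right h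
    omega
  have hm0 : m ≠ 0 := by
    rintro rfl
    exact hN1 ((Nat.coprime_zero_left _).mp hm)
  rcases Nat.even_or_odd m with heven | hodd
  · -- `m` even: `|d_K| M` is odd and `m' = m + |d_K| M` is an odd representative of the class of `m`
    have hNodd : Odd ((discr K).natAbs * M) := by
      rw [← Nat.not_even_iff_odd]
      intro hNe
      have h2 : 2 ∣ Nat.gcd m ((discr K).natAbs * M) :=
        Nat.dvd_gcd (even_iff_two_dvd.mp heven) (even_iff_two_dvd.mp hNe)
      rw [hm] at h2
      omega
    set m' : ℕ := m + (discr K).natAbs * M with hm'def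
    have hm'odd : Odd m' := heven.add_odd hNodd
    have hm'cop : m'.Coprime ((discr K).natAbs * M) := by
      have := (Nat.coprime_add_mul_right_left m ((discr K).natAbs * M) 1).mpr hm
      simpa [hm'def] using this
    have hm'0 : m' ≠ 0 := hm'odd.pos.ne'
    -- the relation on the ray between `(m')` and `(m)`
    have hcopm : IsCoprime (Ideal.span {(m : 𝓞 K)}) 𝔪 :=
      isCoprime_span_natCast_of_coprime_absNorm (Nat.Coprime.coprime_mul_left_right hm)
    have hsub : (m' : 𝓞 K) - (m : 𝓞 K) ∈ 𝔪 := by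
      rw [hm'def, Nat.cast_add, add_sub_cancel_left, Nat.cast_mul]
      exact Ideal.mul_mem_left _ _ (Ideal.absNorm_mem 𝔪)
    have hrel := idealPow_span_eq_of_isGrossencharakter_weight σ k hψG (m' : 𝓞 K) (m : 𝓞 K)
      (by exact_mod_cast hm'0) (by exact_mod_cast hm0) hcopm hsub
    have hσ : σ (((m' : 𝓞 K) : K) / ((m : 𝓞 K) : K)) = (m' : ℂ) / (m : ℂ) := by simp
    rw [hσ, hneb m' hm'odd hm'cop, zpow_natCast_weight_sub_one _ hk] at hrel
    -- `κ(m) = κ(m') = (d_K/m')`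
    have hκ : κ (m : ZMod (discr K).natAbs) = (jacobiSym (discr K) m' : ℂ) := by
      rw [← hκJ m' hm'odd, hm'def]
      congr 1
      push_cast
      rw [ZMod.natCast_self, zero_mul, add_zero]
    have hmC : (m : ℂ) ≠ 0 := by exact_mod_cast hm0
    have hm'C : (m' : ℂ) ≠ 0 := by exact_mod_cast hm'0
    -- solve `J · m'^{k-1} = X · (m'/m)^{k-1}` for `X = ψ̃((m))`
    have hpow : ((m' : ℂ) / m) ^ (k - 1) ≠ 0 := pow_ne_zero _ (div_ne_zero hm'C hmC)
    have hX : idealPow K ψ (Ideal.span {(m : 𝓞 K)}) =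
        (jacobiSym (discr K) m' : ℂ) * (m' : ℂ) ^ (k - 1) / ((m' : ℂ) / m) ^ (k - 1) := by
      rw [eq_div_iff hpow]; exact hrel.symm
    rw [hX, hκ, div_pow, div_div_eq_mul_div, mul_assoc, mul_comm ((m' : ℂ) ^ (k - 1)) ((m : ℂ) ^ (k - 1)),
      ← mul_assoc, mul_div_assoc, div_self (pow_ne_zero _ hm'C), mul_one]
  · rw [hneb m hodd hm, hκJ m hodd]

/-! ### Parity: the trivial-Nebentypus clause forces an even weight -/

/-- **The weight is even.**  Under the Größencharakter relation of type `σ^{k-1}` mod `𝔪 ≠ 0` and the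
clause `ψ̃((n)) = (d_K/n) n^{k-1}` (odd `n` prime to `|d_K| N𝔪`), `k` is even: for the odd
`n = 2|d_K|N𝔪 - 1 ≡ -1`, the relation on the ray (`n - (-1) ∈ 𝔪`) gives `ψ̃((n)) = (-n)^{k-1}`, while
`(d_K/n) = κ(n) = κ(-1) = -1` for the (odd) Kronecker character `κ`; so `(-1)^{k-1} = -1`
(cf. Ribet 1977 §4, proof of (4.1): `(-1)^{k-1} ε(-1) = -1`, here with `ε = 1`).  Hence the fact is
vacuous at odd `k`, consistent with `S_k(Γ₀(N)) = 0` for odd `k`.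
[cite: Ribet1977Nebentypus, §4, proof of Prop. (4.1) (LNM 601, p. 35)] -/
theorem even_weight_of_trivial_nebentypus [IsTotallyComplex K] (hK : finrank ℚ K = 2) (σ : K →+* ℂ)
    {k : ℕ} (hk : 1 ≤ k) {𝔪 : Ideal (𝓞 K)} (h𝔪 : 𝔪 ≠ ⊥) {ψ : HeightOneSpectrum (𝓞 K) → ℂ}
    (hψG : IsGrossencharakter 𝔪 (fun w => ((k : ℤ) - 1) * embType σ w)
      (fun w => ((k : ℤ) - 1) * embTypeConj σ w) ψ)
    (hneb : ∀ n : ℕ, Odd n → n.Coprime ((discr K).natAbs * Ideal.absNorm 𝔪) →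
      idealPow K ψ (Ideal.span {(n : 𝓞 K)}) = (jacobiSym (discr K) n : ℂ) * (n : ℂ) ^ (k - 1)) :
    Even k := by
  classical
  by_contra hkodd
  rw [Nat.not_even_iff_odd] at hkodd
  have hk1 : Even (k - 1) := by
    obtain ⟨j, hj⟩ := hkodd
    exact ⟨j, by omega⟩
  obtain ⟨κ, -, hκodd, -, hκJ, -⟩ := exists_kroneckerChar_odd_jacobiSym_dedekindZeta (K := K) hK
  set N₀ : ℕ := (discr K).natAbs * Ideal.absNorm 𝔪 with hN₀def
  have hD0 : (discr K).natAbs ≠ 0 := Int.natAbs_ne_zero.mpr (NumberField.discr_ne_zero K)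
  have hM0 : Ideal.absNorm 𝔪 ≠ 0 := by rw [Ne, Ideal.absNorm_eq_zero_iff]; exact h𝔪
  have hN₀ : N₀ ≠ 0 := mul_ne_zero hD0 hM0
  -- the odd integer `n = 2 N₀ - 1 ≡ -1 (mod N₀)`
  set n : ℕ := 2 * N₀ - 1 with hndef
  have hn1 : n + 1 = 2 * N₀ := by omega
  have hnodd : Odd n := ⟨N₀ - 1, by omega⟩
  have hn0 : n ≠ 0 := hnodd.pos.ne'
  have hncop : n.Coprime N₀ := by
    rw [← Nat.isCoprime_iff_coprime]
    refine ⟨-1, 2, ?_⟩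
    have : ((n : ℤ) + 1) = 2 * (N₀ : ℤ) := by exact_mod_cast hn1
    linear_combination -this
  -- the clause at `n`
  have hval := hneb n hnodd hncop
  -- the relation on the ray between `(n)` and `(-1)`
  have hcop1 : IsCoprime (Ideal.span {(-1 : 𝓞 K)}) 𝔪 := by
    rw [Ideal.span_singleton_neg, Ideal.span_singleton_one, ← Ideal.one_eq_top]
    exact isCoprime_one_left
  have hsub : (n : 𝓞 K) - (-1) ∈ 𝔪 := by
    have h2 : (n : 𝓞 K) - (-1) = ((n + 1 : ℕ) : 𝓞 K) := by push_cast; ring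
    rw [h2, hn1, hN₀def]
    push_cast
    rw [← mul_assoc]
    exact Ideal.mul_mem_left _ _ (Ideal.absNorm_mem 𝔪)
  have hrel := idealPow_span_eq_of_isGrossencharakter_weight σ k hψG (n : 𝓞 K) (-1)
    (by exact_mod_cast hn0) (neg_ne_zero.mpr one_ne_zero) hcop1 hsub
  have hσ : σ (((n : 𝓞 K) : K) / (((-1 : 𝓞 K)) : K)) = -(n : ℂ) := by simp [div_neg]
  rw [Ideal.span_singleton_neg, Ideal.span_singleton_one, ← Ideal.one_eq_top] at hrel
  rw [Ideal.one_eq_top, idealPow_top, one_mul, hσ, zpow_natCast_weight_sub_one _ hk, hk1.neg_pow, hval] at hrel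
  -- so `(d_K/n) = 1` ...
  have hnC : (n : ℂ) ^ (k - 1) ≠ 0 := pow_ne_zero _ (by exact_mod_cast hn0)
  have hJ1 : (jacobiSym (discr K) n : ℂ) = 1 := by
    have := mul_right_cancel₀ hnC (hrel.trans (one_mul _).symm)
    exact this
  -- ... but `(d_K/n) = κ(n) = κ(-1) = -1`
  have hnZ : ((n : ℕ) : ZMod (discr K).natAbs) = -1 := by
    have h0 : ((n : ℕ) : ZMod (discr K).natAbs) + 1 = 0 := by
      have h2 : ((n : ℕ) : ZMod (discr K).natAbs) + 1 = ((n + 1 : ℕ) : ZMod (discr K).natAbs) := by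
        push_cast; ring
      rw [h2, hn1, hN₀def]
      push_cast
      rw [ZMod.natCast_self, zero_mul, mul_zero]
    exact eq_neg_of_add_eq_zero_left h0
  have hκn : κ n = -1 := by
    rw [hnZ]; exact hκodd
  rw [hκJ n hnodd, hJ1] at hκn
  norm_num at hκn

end Literature.NumberTheory.EllipticCurves.ModularForms

end
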